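import Mathlib.GroupTheory.SpecificGroups.Dihedral
import Mathlib.Tactic.LinearCombination
import Literature.Combinatorics.Additive.TripleProductProperty

/-!
# ω-census, family (b3): the dihedral TPP family `({1,s}, {1,sr}, ⟨r³⟩ ∪ s r² ⟨r³⟩)` in `D_{6m}` — for ALL `m`

HONEST FRAMING (pub-omega census; verbatim): lottery ticket; floor = certified bounds/negative ranges.
OUR structural result (small, new as a uniform statement; the instances `m ≤ 8` are kernel-checked by `decide` in
`DihedralTPPFamily.lean` / `Dihedral12TPPVolume.lean`): for every `m ≥ 1`, in `DihedralGroup (3m)` (order `6m`) the sets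
`S = {1, s}`, `T = {1, s r}`, `U = {r^{3j}} ∪ {s r^{2+3j}}` satisfy the triple product property (Cohn–Umans).  `U` has `2m`
elements (the two images of `j ↦ 3j` on `ZMod (3m)` have `m` elements each; not re-proved here), so the volume is `8m = (4/3)|G|`,
matching the census law `β(D_{2n}) = 4⌊2n/3⌋` (SAT-verified for `n ≤ 24`, kit j086172) on `3 ∣ n`.  Proof: the 64 membership cases
reduce (Mathlib's `DihedralGroup` multiplication rules) to linear equations in `ZMod (3m)`; the legitimate ones give `u = u'`, the
others assert `3x ∈ {±1, ±2}`, impossible modulo `3` (`three_mul_ne_small`, via `ZMod.castHom` to `ZMod 3`).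
-/

namespace Summit.MatrixMultiplication.OmegaCensus
open Literature.Combinatorics.Additive Finset

/-- In `ZMod (3m)` a multiple of `3` is never `1`, `2`, `−1` or `−2` (reduce modulo `3`). [folklore] -/
theorem three_mul_ne_small (m : ℕ) [NeZero m] (x : ZMod (3 * m)) :
    3 * x ≠ 1 ∧ 3 * x ≠ 2 ∧ 3 * x ≠ -1 ∧ 3 * x ≠ -2 := by
  have h3 : (3 : ℕ) ∣ 3 * m := dvd_mul_right 3 m
  let φ := ZMod.castHom h3 (ZMod 3)
  have hφ3 : φ (3 * x) = 0 := by
    rw [map_mul]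
    have : φ 3 = 0 := by
      rw [map_ofNat]; decide
    rw [this, zero_mul]
  refine ⟨fun h => ?_, fun h => ?_, fun h => ?_, fun h => ?_⟩ <;>
  · have := congrArg φ h
    rw [hφ3] at this
    revert this
    simp only [map_one, map_neg, map_ofNat]
    decide

/-- **The dihedral TPP family** (ω-census, ours): for every `m ≥ 1`, in `D_{6m} = DihedralGroup (3m)` the triple `S = {1, s}`,
`T = {1, s r}`, `U = {r^{3j}} ∪ {s r^{2+3j}}` (= `⟨r³⟩ ∪ s r² ⟨r³⟩`, sizes `2, 2, 2m`) has the triple product property. [folklore] -/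
theorem dihedral_family_tpp (m : ℕ) [NeZero m] :
    TripleProductProperty ({DihedralGroup.r 0, DihedralGroup.sr 0} : Finset (DihedralGroup (3 * m)))
      ({DihedralGroup.r 0, DihedralGroup.sr 1} : Finset (DihedralGroup (3 * m)))
      ((univ.image fun j : ZMod (3 * m) => DihedralGroup.r (3 * j)) ∪
        (univ.image fun j : ZMod (3 * m) => DihedralGroup.sr (2 + 3 * j))) := by
  have key := three_mul_ne_small m
  intro s hs s' hs' t ht t' ht' u hu u' hu' heq
  simp only [mem_insert, mem_singleton, mem_union, mem_image, mem_univ, true_and] at hs hs' ht ht' hu hu'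
  rcases hu with ⟨j, rfl⟩ | ⟨j, rfl⟩ <;> rcases hu' with ⟨j', rfl⟩ | ⟨j', rfl⟩ <;>
  rcases hs with rfl | rfl <;> rcases hs' with rfl | rfl <;> rcases ht with rfl | rfl <;> rcases ht' with rfl | rfl <;>
  simp only [DihedralGroup.r_mul_r, DihedralGroup.r_mul_sr, DihedralGroup.sr_mul_r, DihedralGroup.sr_mul_sr,
    DihedralGroup.inv_r, DihedralGroup.inv_sr, DihedralGroup.one_def, DihedralGroup.r.injEq, DihedralGroup.sr.injEq,
    reduceCtorEq, true_and, and_self, neg_zero, add_zero, zero_add, sub_zero, sub_self] at heq ⊢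
  all_goals first
    | linear_combination heq
    | linear_combination -heq
    | (exfalso; first
        | exact ((key (j - j')).1) (by linear_combination heq)
        | exact ((key (j - j')).1) (by linear_combination -heq)
        | exact ((key (j - j')).2.1) (by linear_combination heq)
        | exact ((key (j - j')).2.1) (by linear_combination -heq)
        | exact ((key (j - j')).2.2.1) (by linear_combination heq)
        | exact ((key (j - j')).2.2.1) (by linear_combination -heq)
        | exact ((key (j - j')).2.2.2) (by linear_combination heq))

end Summit.MatrixMultiplication.OmegaCensus
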